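import Literature.MathematicalPhysics.QuantumLattice.HubbardNNNHoppingEnergyDensityConvex
import HarnessLib

/-!
# Affine lower bounds on the `t–t'` energy density extend from the open density interval to `m = 0`

Topic `Literature/MathematicalPhysics/QuantumLattice` (namespace = path; family `hubbard`). One model fact
for the Hubbard cuprate cell (`hubbard-cq`, lead RULING 124 (2)(a): the OPEN-BINDER ⇒ CLOSED-BINDER adapter
for tangent-node consumers): a certified `n`-tangent node states `c + μ m ≤ e(t,t',U,m)` on the OPEN interval
`0 < m < 2` (e.g. the #504 / #508 nodes of the `CertifiedManyBodySolver` venture), whereas the «sheet»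
consumers take the CLOSED binder `0 ≤ m < 2`. Convexity of `m ↦ e(t,t',U,m)` on `[0,2)`
(`convexOn_energyDensityTT'`) makes the endpoint automatic: `e(s) ≤ (1−s)e(0) + s·e(1)` for `s ∈ (0,1]`, and
`s → 0⁺` in `c + μ s ≤ e(s)` gives `c ≤ e(0)`. (The same argument sits inside the tree's
`ThermodynamicLimit.le_gcEnergyDensityTT'_of_Ioo`; here it is exposed for the canonical density itself.)

* `energyDensityTT'_affine_le_of_Ioo` — `(∀ m ∈ (0,2), c + μ m ≤ e(m)) → ∀ m ∈ [0,2), c + μ m ≤ e(m)`;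
* `energyDensityTT'_tangent_le_of_Ioo` — the same for the tangent spelling `ℓ + μ(m − n₀)`.

Everything PROVED; no definition, no named fact.

References: D. Ruelle, *Statistical Mechanics* (1969), §3.4 (convexity of the energy density in the density).
-/

noncomputable section

namespace Literature.MathematicalPhysics.QuantumLattice

open ThermodynamicLimit

namespace ThermodynamicLimit

/-- **Interior affine bounds reach the empty-lattice endpoint.** For `U ≥ 0`: if `c + μ m ≤ e(t,t',U,m)` for
all `0 < m < 2` then also for all `0 ≤ m < 2` (convexity of `e` on `[0,2)` and `m → 0⁺`).
[cite: Ruelle1969, §3.4] -/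
theorem energyDensityTT'_affine_le_of_Ioo (t t' : ℝ) {U : ℝ} (hU : 0 ≤ U) {c μ : ℝ}
    (hc : ∀ m : ℝ, 0 < m → m < 2 → c + μ * m ≤ energyDensityTT' t t' U m) :
    ∀ m : ℝ, 0 ≤ m → m < 2 → c + μ * m ≤ energyDensityTT' t t' U m := by
  intro m hm0 hm2
  rcases hm0.lt_or_eq with hpos | h0
  · exact hc m hpos hm2
  · -- the endpoint `m = 0`
    subst h0
    rw [mul_zero, add_zero]
    set e0 := energyDensityTT' t t' U 0 with he0
    set e1 := energyDensityTT' t t' U 1 with he1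
    have hconv := convexOn_energyDensityTT' t t' hU
    -- `e(s) ≤ (1 - s) e(0) + s e(1)` for `s ∈ (0, 1]`
    have hch : ∀ s : ℝ, 0 < s → s ≤ 1 → energyDensityTT' t t' U s ≤ (1 - s) * e0 + s * e1 := by
      intro s hs hs1
      have h := hconv.2 (show (0 : ℝ) ∈ Set.Ico (0 : ℝ) 2 from ⟨le_rfl, two_pos⟩)
        (show (1 : ℝ) ∈ Set.Ico (0 : ℝ) 2 from ⟨zero_le_one, one_lt_two⟩)
        (show (0 : ℝ) ≤ 1 - s by linarith) hs.le (show (1 - s) + s = 1 by ring)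
      simp only [smul_eq_mul, mul_zero, zero_add, mul_one] at h
      exact h
    by_contra hlt
    rw [not_le] at hlt
    -- choose `s` small: `s · |e1 - e0 - μ| < c - e0`
    obtain ⟨s, hs, hs1, hsmall⟩ : ∃ s : ℝ, 0 < s ∧ s ≤ 1 ∧ s * |e1 - e0 - μ| < c - e0 := by
      refine ⟨min 1 ((c - e0) / (2 * (|e1 - e0 - μ| + 1))), ?_, min_le_left _ _, ?_⟩
      · exact lt_min one_pos (div_pos (sub_pos.2 hlt) (by positivity))
      · have hA : 0 ≤ |e1 - e0 - μ| := abs_nonneg _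
        have hle : min 1 ((c - e0) / (2 * (|e1 - e0 - μ| + 1))) * |e1 - e0 - μ| ≤
            (c - e0) / (2 * (|e1 - e0 - μ| + 1)) * |e1 - e0 - μ| :=
          mul_le_mul_of_nonneg_right (min_le_right _ _) hA
        have hlt2 : (c - e0) / (2 * (|e1 - e0 - μ| + 1)) * |e1 - e0 - μ| < c - e0 := by
          rw [div_mul_eq_mul_div, div_lt_iff₀ (by positivity)]
          nlinarith [sub_pos.2 hlt]
        exact hle.trans_lt hlt2
    have h1 := hc s hs (by linarith)
    have h2 := hch s hs hs1
    have h3 : s * (e1 - e0 - μ) ≤ s * |e1 - e0 - μ| := mul_le_mul_of_nonneg_left (le_abs_self _) hs.le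
    nlinarith

/-- The tangent spelling: `(∀ m ∈ (0,2), ℓ + μ(m − n₀) ≤ e(m)) → ∀ m ∈ [0,2), ℓ + μ(m − n₀) ≤ e(m)` (`U ≥ 0`).
[cite: Ruelle1969, §3.4] -/
theorem energyDensityTT'_tangent_le_of_Ioo (t t' : ℝ) {U : ℝ} (hU : 0 ≤ U) {ℓ μ n₀ : ℝ}
    (h : ∀ m : ℝ, 0 < m → m < 2 → ℓ + μ * (m - n₀) ≤ energyDensityTT' t t' U m) :
    ∀ m : ℝ, 0 ≤ m → m < 2 → ℓ + μ * (m - n₀) ≤ energyDensityTT' t t' U m := by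
  have h' := energyDensityTT'_affine_le_of_Ioo t t' hU (c := ℓ - μ * n₀) (μ := μ)
    (fun m hm0 hm2 => by have := h m hm0 hm2; linarith)
  intro m hm0 hm2
  have := h' m hm0 hm2
  linarith

end ThermodynamicLimit

end Literature.MathematicalPhysics.QuantumLattice

end
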